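import Mathlib
import Summits.Ventures.PercRepro2.Defs
import Summits.Ventures.PercRepro2.Independence
import Summits.Ventures.PercRepro2.Harris

/-!
# Pinned weight vectors: point masses and two-point laws (blind cell PercRepro2, typer-1; for
mine-a g3 MINE-A.md §16 (c) "on every PINNED line (all edges but `e` at 0/1 — a two-point law under
`Q`) `G ≡ 0`", lead g11 13:50:52Z "worth a Lean statement — typer queue after L1S")

* `pinnedConfig p = (fun e => decide (p e = 1))`: the configuration a `{0,1}`-valued weight vector
  forces; `weight_eq_of_pinned`: its weight is `1` and every other configuration has weight `0`;
  `prob_eq_indicator_of_pinned`: `P_p(A) = 1[pinnedConfig p ∈ A]` — the law is a point mass;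
* **`prob_eq_two_point`**: if every edge but `e` is pinned to `0` or `1`, then for every event `A`
  `P_p(A) = (1 − p e) · 1[ω₀ ∈ A] + p e · 1[ω₁ ∈ A]` with `ω₀ = pinnedConfig (p[e ↦ 0])` and
  `ω₁ = ω₀[e ↦ open]` — a two-point law on the `e`-line, affine in `t = p e`.
-/

namespace Summit.Ventures.PercRepro2

namespace Pinned

open scoped Classical

variable {E : Type*} [Fintype E] [DecidableEq E] {R : Type*} [CommRing R]

/-- A weight vector is pinned if every weight is `0` or `1`. -/
def IsPinned (p : E → R) : Prop := ∀ e, p e = 0 ∨ p e = 1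

/-- The configuration forced by a pinned weight vector: `e` is open iff `p e = 1`. -/
noncomputable def pinnedConfig (p : E → R) : Config E := fun e => decide (p e = 1)

omit [Fintype E] [DecidableEq E] in
/-- `pinnedConfig` on an edge of weight `1`. -/
lemma pinnedConfig_of_eq_one {p : E → R} {e : E} (h : p e = 1) : pinnedConfig p e = true := by
  simp [pinnedConfig, h]

omit [Fintype E] [DecidableEq E] in
/-- `pinnedConfig` on an edge of weight `0` (`R` nontrivial). -/
lemma pinnedConfig_of_eq_zero [Nontrivial R] {p : E → R} {e : E} (h : p e = 0) :
    pinnedConfig p e = false := by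
  simp [pinnedConfig, h]

omit [Fintype E] [DecidableEq E] in
/-- The Bernoulli factor of a pinned edge is `1` at the forced state and `0` otherwise. -/
lemma edgeFactor_of_pinned [Nontrivial R] {q : R} (hq : q = 0 ∨ q = 1) (b : Bool) :
    edgeFactor q b = if b = decide (q = 1) then 1 else 0 := by
  rcases hq with rfl | rfl <;> cases b <;> simp [edgeFactor]

omit [DecidableEq E] in
/-- **A pinned weight vector is a point mass**: `weight p ω = 1[ω = pinnedConfig p]`. -/
lemma weight_eq_of_pinned [Nontrivial R] {p : E → R} (hp : IsPinned p) (ω : Config E) :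
    weight p ω = if ω = pinnedConfig p then 1 else 0 := by
  unfold weight
  by_cases h : ω = pinnedConfig p
  · rw [if_pos h]
    refine Finset.prod_eq_one fun e _ => ?_
    rw [edgeFactor_of_pinned (hp e), if_pos]
    rw [h]; rfl
  · rw [if_neg h]
    obtain ⟨e, he⟩ : ∃ e, ω e ≠ pinnedConfig p e := by
      by_contra hcon
      exact h (funext fun e => by_contra fun hne => hcon ⟨e, hne⟩)
    refine Finset.prod_eq_zero (Finset.mem_univ e) ?_
    rw [edgeFactor_of_pinned (hp e), if_neg]
    exact he

/-- **`P_p(A) = 1[pinnedConfig p ∈ A]`** for a pinned weight vector. -/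
lemma prob_eq_indicator_of_pinned [Nontrivial R] {p : E → R} (hp : IsPinned p)
    (A : Set (Config E)) : prob p A = A.indicator 1 (pinnedConfig p) := by
  unfold prob
  rw [Finset.sum_eq_single (pinnedConfig p)]
  · by_cases h : pinnedConfig p ∈ A
    · rw [Set.indicator_of_mem h, Set.indicator_of_mem h, weight_eq_of_pinned hp, if_pos rfl]; rfl
    · rw [Set.indicator_of_notMem h, Set.indicator_of_notMem h]
  · intro ω _ hω
    rw [Set.indicator_apply, weight_eq_of_pinned hp, if_neg hω]
    simp
  · intro h
    exact absurd (Finset.mem_univ _) h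

omit [Fintype E] in
/-- Pinning the free edge of a vector that is pinned away from `e` gives a pinned vector. -/
lemma isPinned_update {p : E → R} {e : E} (hp : ∀ e', e' ≠ e → p e' = 0 ∨ p e' = 1) {q : R}
    (hq : q = 0 ∨ q = 1) : IsPinned (Function.update p e q) := by
  intro e'
  by_cases h : e' = e
  · subst h; simpa using hq
  · rw [Function.update_of_ne h]; exact hp e' h

omit [Fintype E] in
/-- The forced configuration of `p[e ↦ 1]` is that of `p[e ↦ 0]` with `e` opened. -/
lemma pinnedConfig_update_one [Nontrivial R] (p : E → R) (e : E) :
    pinnedConfig (Function.update p e 1) =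
      Function.update (pinnedConfig (Function.update p e 0)) e true := by
  funext e'
  by_cases h : e' = e
  · subst h; simp [pinnedConfig]
  · rw [Function.update_of_ne h]
    simp [pinnedConfig, Function.update_of_ne h]

/-- **The two-point law on the `e`-line**: if every edge but `e` is pinned,
`P_p(A) = (1 − p e) · 1[ω₀ ∈ A] + p e · 1[ω₀[e ↦ open] ∈ A]`, `ω₀ = pinnedConfig (p[e ↦ 0])`. -/
theorem prob_eq_two_point [Nontrivial R] {p : E → R} {e : E}
    (hp : ∀ e', e' ≠ e → p e' = 0 ∨ p e' = 1) (A : Set (Config E)) :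
    prob p A = (1 - p e) * A.indicator 1 (pinnedConfig (Function.update p e 0)) +
      p e * A.indicator 1 (Function.update (pinnedConfig (Function.update p e 0)) e true) := by
  rw [prob_eq_pin p A e, prob_eq_indicator_of_pinned (isPinned_update hp (Or.inr rfl)),
    prob_eq_indicator_of_pinned (isPinned_update hp (Or.inl rfl)), pinnedConfig_update_one]
  ring

end Pinned

end Summit.Ventures.PercRepro2
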